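import Summits.HodgeConjecture.CorCM.Prior.AllgGroup2

/-!
# The block-parity law, I: base change of abstract CM types, blocks, block parities, and the counting engine

COR-CM (cell `pub-hodgecm2`), count-neutral kernel combinatorics by the binder seat b09 (gen 28; lane BLOCK-PARITY-FLOOR),
part I.  Bookkeeping definitions + theorems; no `decide` beyond `(1 : ZMod 2) + 1 = 0`, no certificate, no named fact, no
`sorry`; `Interfaces.lean` (C1), every E term, B01, `Transposition/*` untouched.  HONEST FRAMING: `HC_CM` is NOT proved, here or
anywhere in the tree; nothing here is a period or a headline.

THE SETTING is the abstract currency of `CorCM/Prior/AllgGroup1.lean` (rfwf `l:allg`): `G` a finite group, `c : G` an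
involution (`c * c = 1`, `c ≠ 1`; centrality is needed only where stated), `CMF G c` the CM types `Ψ ⊆ G` (`G = Ψ ⊔ cΨ`),
`ℤ[types] = CMF G c →₀ ℤ`, the faces `gface Φ t t' = [Φ] + [Φ^{(tt')}] − [Φ^{(t)}] − [Φ^{(t')}]` (`gfaceSet`).  For a Galois CM
field `F` this is `G = GalT F`, `c = conjT` (`CorCM/CM/LefschetzChar1.lean`), and the `σ`-reads of the rank-four faces of `F`
are exactly `ā` of the `gface`s (`CorCM/FaceCharacterReads.lefChar_corner_eq_abar_gface`, seat b23).

CONTENT.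
* §1 **Base change** `rt Q Ψ = Ψ·Q⁻¹ = {P | P·Q ∈ Ψ}` (`mem_rt`; for `F` this is `pullType (pushType σ₀ Ψ) (Q σ₀)` of
  `CorCM/FaceCensusOrbitTransport.mem_pullType_pushType`, i.e. reading the same CM type at the base embedding `Q σ₀`); it is an
  action (`rt_one`, `rt_mul`), commutes with flips (`rt_oflipCM`: `(Ψ^{(t)})·Q⁻¹ = (Ψ·Q⁻¹)^{(tQ⁻¹)}`), and for CENTRAL `c` the
  conjugate type is a base change: `Ψ̄ = Ψ·c` (`rt_self_val`).
* §2 **Blocks** = orbits of base change (`blockSetoid`, `Block`, `blk`, `blk_rt`).  DICTIONARY (cited, not formalised, as in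
  `Census/OddDegreeParityLaw.lean`): blocks ↔ isogeny classes of simple CM abelian varieties whose CM is split by `F`
  [cite: Milne1999, Prop. 2.1, p. 54]; their number `β(G,c) = Fintype.card (Block c)` is, by Burnside, `(1/|G|) Σ_{g : c ∉ ⟨g⟩} 2^{|G|/(2·ord g)}`
  (e.g. `β(ℤ/2m) = (1/2m) Σ_{d | m, d odd} φ(d) 2^{m/d} = 2, 2, 4, 6, 10, 16, 30, 52, 94` for `2m = 6 … 22`; not decided here).
* §3 **Block parities** `par : ℤ[types] →ₗ[ℤ] (Block c → 𝔽₂)`, `[Ψ] ↦ e_{blk Ψ}` (`par_single`): base-change invariant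
  (`par_mapDomain_rt`) and, for central `c`, killing the pairs `[Ψ] + [Ψ̄]` (`par_pair`).
* §4 **The counting engine** (`span_par_le`, `finrank_span_par_le_card`): if a set `X ⊆ ℤ[types]` lies in
  `P₀ + Σ_{s ∈ S} ℤ[G]·s` for a submodule `P₀` killed by `par` (the pairs) and a finite family `S`, then
  `span_𝔽₂ (par X) ≤ span_𝔽₂ (par S)`, so `dim_𝔽₂ span (par X) ≤ |S|`.  Part II (`Census/BlockParityRelations.lean`) computes
  `dim_𝔽₂ span (par (faces)) = β − 1 − δ` EXACTLY, whence the law `|S| ≥ β − 1 − δ` for every `(G, c)`.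
* §5 **The weight parity** `wpar T₀ Ψ = |T₀ ∖ Ψ| mod 2` (number of places where `Ψ` deviates from the base type `T₀`), its
  behaviour under flips (`wpar_oflipCM`: every flip changes it) and the invariance predicate `WInv c T₀` («the weight parity is
  constant on blocks»), with `δ = wdelta c T₀ ∈ {0, 1}`; the two universal relations: the total parity of a face is `0`
  (`sum_par_gface`) and the weighted parity of a face is `0` (`wsum_gface`).

## References
* [Pohlmann1968] H. Pohlmann, Algebraic cycles on abelian varieties of complex multiplication type, Ann. of Math. 88 (1968), Thm 1.
* [Milne1999] J. S. Milne, Lefschetz motives and the Tate conjecture, Compositio Math. 117 (1999), Prop. 2.1, p. 54.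
-/

namespace Summit.HodgeConjecture.CorCM.Census.BlockParity

open Finset
open Summit.HodgeConjecture.CorCM.Prior.AllgGroup.RfwfAllgGroup

noncomputable section

variable {G : Type*} [Group G] [Fintype G] [DecidableEq G] (c : G)

/-! ## §1 Base change of abstract CM types -/

/-- **Base change** of an abstract CM type along `Q`: `Ψ·Q⁻¹ = {P | P·Q ∈ Ψ}` (reading the type at the base embedding `Q σ₀`).
[folklore] -/
def rt (Q : G) (Ψ : CMF G c) : CMF G c :=
  ⟨univ.filter fun P => P * Q ∈ Ψ.1, by
    intro x
    simp only [mem_filter, mem_univ, true_and, mul_assoc]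
    exact Ψ.2 (x * Q)⟩

/-- Membership in a base change: `P ∈ Ψ·Q⁻¹ ↔ P·Q ∈ Ψ`. [folklore] -/
@[simp] theorem mem_rt (Q : G) (Ψ : CMF G c) (P : G) : P ∈ (rt c Q Ψ).1 ↔ P * Q ∈ Ψ.1 := by
  simp [rt]

/-- Base change along `1` is the identity. [folklore] -/
@[simp] theorem rt_one (Ψ : CMF G c) : rt c 1 Ψ = Ψ := by
  apply Subtype.ext; ext P; simp

/-- Base change is an action: `Ψ·(QQ')⁻¹ = (Ψ·Q'⁻¹)·Q⁻¹`. [folklore] -/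
theorem rt_mul (Q Q' : G) (Ψ : CMF G c) : rt c (Q * Q') Ψ = rt c Q (rt c Q' Ψ) := by
  apply Subtype.ext; ext P; simp [mul_assoc]

/-- Cancellation `(Ψ·Q⁻¹)·Q = Ψ`. [folklore] -/
theorem rt_inv_rt (Q : G) (Ψ : CMF G c) : rt c Q⁻¹ (rt c Q Ψ) = Ψ := by
  rw [← rt_mul, inv_mul_cancel, rt_one]

/-- Cancellation `(Ψ·Q)·Q⁻¹ = Ψ`. [folklore] -/
theorem rt_rt_inv (Q : G) (Ψ : CMF G c) : rt c Q (rt c Q⁻¹ Ψ) = Ψ := by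
  rw [← rt_mul, mul_inv_cancel, rt_one]

/-- Base change along `Q` is a bijection of CM types. [folklore] -/
theorem rt_bijective (Q : G) : Function.Bijective (rt c Q) :=
  ⟨fun Ψ Ψ' h => by rw [← rt_inv_rt c Q Ψ, h, rt_inv_rt], fun Ψ => ⟨rt c Q⁻¹ Ψ, rt_rt_inv c Q Ψ⟩⟩

omit [Fintype G] in
/-- The place of `t·Q⁻¹` is the place of `t` translated: `x·Q ∈ {t, ct} ↔ x ∈ {tQ⁻¹, c·tQ⁻¹}`. [folklore] -/
theorem mul_mem_orb_iff (Q t x : G) : x * Q ∈ orb c t ↔ x ∈ orb c (t * Q⁻¹) := by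
  rw [mem_orb, mem_orb, ← mul_assoc, eq_mul_inv_iff_mul_eq, eq_mul_inv_iff_mul_eq]

/-- **Base change commutes with flips**: `(Ψ^{(t)})·Q⁻¹ = (Ψ·Q⁻¹)^{(tQ⁻¹)}`. [folklore] -/
theorem rt_oflipCM (hc2 : c * c = 1) (Q t : G) (Ψ : CMF G c) :
    rt c Q (oflipCM c hc2 t Ψ) = oflipCM c hc2 (t * Q⁻¹) (rt c Q Ψ) := by
  apply Subtype.ext; ext P
  change P ∈ (rt c Q (oflipCM c hc2 t Ψ)).1 ↔ P ∈ oflip c (t * Q⁻¹) (rt c Q Ψ).1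
  rw [mem_rt, oflip, mem_symmDiff, mem_rt, ← mul_mem_orb_iff]
  change P * Q ∈ oflip c t Ψ.1 ↔ _
  rw [oflip, mem_symmDiff]

/-- For CENTRAL `c` **the conjugate type is the base change along `c`**: `Ψ·c = G ∖ Ψ = Ψ̄`. [folklore] -/
theorem rt_self_val (hc : ∀ x : G, x * c = c * x) (Ψ : CMF G c) : (rt c c Ψ).1 = univ \ Ψ.1 := by
  ext P
  rw [mem_rt, mem_sdiff, hc P]
  have h := Ψ.2 P
  simp only [mem_univ, true_and]
  tauto

/-! ## §2 Blocks -/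

/-- Two abstract CM types are in the same **block** iff they differ by a base change. [folklore] -/
def blockSetoid : Setoid (CMF G c) where
  r Ψ Ψ' := ∃ Q : G, rt c Q Ψ = Ψ'
  iseqv :=
    ⟨fun Ψ => ⟨1, rt_one c Ψ⟩,
      fun {Ψ Ψ'} h => by
        obtain ⟨Q, hQ⟩ := h
        exact ⟨Q⁻¹, by rw [← hQ, rt_inv_rt]⟩,
      fun {Ψ Ψ' Ψ''} h h' => by
        obtain ⟨Q, hQ⟩ := h
        obtain ⟨Q', hQ'⟩ := h'
        exact ⟨Q' * Q, by rw [rt_mul, hQ, hQ']⟩⟩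

/-- **The blocks** of `(G, c)`: orbits of CM types under base change (↔ simple CM isogeny classes split by `F`).
[cite: Milne1999, Prop. 2.1, p. 54] -/
abbrev Block : Type _ := Quotient (blockSetoid c)

/-- The blocks form a finite type. [folklore] -/
instance : Fintype (Block c) := Fintype.ofFinite _

/-- Equality of blocks is (classically) decidable. [folklore] -/
instance : DecidableEq (Block c) := Classical.typeDecidableEq _

/-- The block of a type. [folklore] -/
def blk (Ψ : CMF G c) : Block c := Quotient.mk (blockSetoid c) Ψ

/-- Every block has a representative type. [folklore] -/
theorem blk_surjective : Function.Surjective (blk c) := Quotient.mk_surjective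

/-- **Base change does not change the block.** [folklore] -/
@[simp] theorem blk_rt (Q : G) (Ψ : CMF G c) : blk c (rt c Q Ψ) = blk c Ψ :=
  Quotient.sound ⟨Q⁻¹, rt_inv_rt c Q Ψ⟩

/-- Types in one block differ by a base change. [folklore] -/
theorem exists_rt_eq_of_blk_eq {Ψ Ψ' : CMF G c} (h : blk c Ψ = blk c Ψ') : ∃ Q : G, rt c Q Ψ = Ψ' :=
  Quotient.exact h

/-! ## §3 Block parities -/

/-- **The block parities** `par : ℤ[types] → 𝔽₂^{blocks}`, `[Ψ] ↦ e_{blk Ψ}`. [folklore] -/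
def par : (CMF G c →₀ ℤ) →ₗ[ℤ] (Block c → ZMod 2) :=
  Finsupp.linearCombination ℤ fun Ψ => Pi.single (blk c Ψ) (1 : ZMod 2)

/-- `par [Ψ]·n = n · e_{blk Ψ}`. [folklore] -/
@[simp] theorem par_single (Ψ : CMF G c) (n : ℤ) : par c (Finsupp.single Ψ n) = n • Pi.single (blk c Ψ) (1 : ZMod 2) := by
  simp [par, Finsupp.linearCombination_single]

/-- Coordinates of `par [Ψ]·n`. [folklore] -/
theorem par_single_apply (Ψ : CMF G c) (n : ℤ) (B : Block c) :
    par c (Finsupp.single Ψ n) B = if blk c Ψ = B then (n : ZMod 2) else 0 := by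
  rw [par_single, Pi.smul_apply, Pi.single_apply]
  split_ifs with h1 h2 h2
  · simp
  · exact absurd h1.symm h2
  · exact absurd h2.symm h1
  · simp

/-- **Block parities are base-change invariant.** [folklore] -/
theorem par_mapDomain_rt (Q : G) (y : CMF G c →₀ ℤ) : par c (Finsupp.mapDomain (rt c Q) y) = par c y := by
  unfold par
  rw [Finsupp.linearCombination_mapDomain]
  have h : ((fun Ψ : CMF G c => (Pi.single (blk c Ψ) (1 : ZMod 2) : Block c → ZMod 2)) ∘ rt c Q) =
      fun Ψ : CMF G c => (Pi.single (blk c Ψ) (1 : ZMod 2) : Block c → ZMod 2) := by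
    funext Ψ; simp
  rw [h]

/-- For central `c`, **block parities kill the pairs** `[Ψ] + [Ψ·c] = [Ψ] + [Ψ̄]`. [folklore] -/
theorem par_pair (Ψ : CMF G c) : par c (Finsupp.single Ψ 1 + Finsupp.single (rt c c Ψ) 1) = 0 := by
  rw [map_add, par_single, par_single, blk_rt, one_smul, ← Pi.single_add]
  have h : (1 : ZMod 2) + 1 = 0 := by decide
  rw [h, Pi.single_zero]

/-! ## §4 The counting engine -/

/-- The `ℤ[G]`-module generated by a family `S`, as a `ℤ`-span of base changes. [folklore] -/
def translates (S : Finset (CMF G c →₀ ℤ)) : Set (CMF G c →₀ ℤ) :=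
  {y | ∃ Q : G, ∃ s ∈ S, y = Finsupp.mapDomain (rt c Q) s}

/-- **Engine, span form.**  If `X ⊆ P₀ + ℤ[G]·S` with `par P₀ = 0`, then `span_𝔽₂ (par X) ≤ span_𝔽₂ (par S)`. [folklore] -/
theorem span_par_le (S : Finset (CMF G c →₀ ℤ)) (P₀ : Submodule ℤ (CMF G c →₀ ℤ)) (hP₀ : ∀ y ∈ P₀, par c y = 0)
    {X : Set (CMF G c →₀ ℤ)} (hX : X ⊆ ↑(P₀ ⊔ Submodule.span ℤ (translates c S))) :
    Submodule.span (ZMod 2) (par c '' X) ≤ Submodule.span (ZMod 2) (par c '' (S : Set (CMF G c →₀ ℤ))) := by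
  rw [Submodule.span_le]
  rintro _ ⟨x, hx, rfl⟩
  obtain ⟨p, hp, z, hz, hpz⟩ := Submodule.mem_sup.mp (hX hx)
  rw [← hpz, map_add, hP₀ p hp, zero_add]
  have hz' : par c z ∈ Submodule.span ℤ (par c '' (S : Set (CMF G c →₀ ℤ))) := by
    have hmap : Submodule.map (par c) (Submodule.span ℤ (translates c S)) ≤
        Submodule.span ℤ (par c '' (S : Set (CMF G c →₀ ℤ))) := by
      rw [Submodule.map_span, Submodule.span_le]
      rintro _ ⟨y, ⟨Q, s, hs, rfl⟩, rfl⟩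
      rw [par_mapDomain_rt]
      exact Submodule.subset_span ⟨s, hs, rfl⟩
    exact hmap (Submodule.mem_map_of_mem hz)
  exact (Submodule.span_le_restrictScalars (R := ℤ) (S := ZMod 2) (s := par c '' (S : Set (CMF G c →₀ ℤ)))) hz'

/-- **Engine, counting form.**  If `X ⊆ P₀ + ℤ[G]·S` with `par P₀ = 0`, then `dim_𝔽₂ span (par X) ≤ |S|`. [folklore] -/
theorem finrank_span_par_le_card (S : Finset (CMF G c →₀ ℤ)) (P₀ : Submodule ℤ (CMF G c →₀ ℤ))
    (hP₀ : ∀ y ∈ P₀, par c y = 0) {X : Set (CMF G c →₀ ℤ)} (hX : X ⊆ ↑(P₀ ⊔ Submodule.span ℤ (translates c S))) :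
    Module.finrank (ZMod 2) (Submodule.span (ZMod 2) (par c '' X)) ≤ S.card := by
  classical
  refine (Submodule.finrank_mono (span_par_le c S P₀ hP₀ hX)).trans ?_
  rw [← Finset.coe_image]
  exact (finrank_span_finset_le_card (S.image (par c))).trans Finset.card_image_le

/-! ## §5 The weight parity and the two universal relations -/

/-- **The weight parity** of `Ψ` relative to the base type `T₀`: the number of places where `Ψ` deviates from `T₀`, mod `2`.
[folklore] -/
def wpar (T₀ Ψ : CMF G c) : ZMod 2 := ((T₀.1 \ Ψ.1).card : ZMod 2)

/-- **The weighted parity** `ℤ[types] → 𝔽₂`, `[Ψ] ↦ wpar T₀ Ψ`. [folklore] -/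
def wlin (T₀ : CMF G c) : (CMF G c →₀ ℤ) →ₗ[ℤ] ZMod 2 :=
  Finsupp.linearCombination ℤ (wpar c T₀)

/-- `wlin [Ψ]·n = n · wpar Ψ`. [folklore] -/
@[simp] theorem wlin_single (T₀ Ψ : CMF G c) (n : ℤ) : wlin c T₀ (Finsupp.single Ψ n) = (n : ZMod 2) * wpar c T₀ Ψ := by
  simp [wlin, Finsupp.linearCombination_single]

/-- `δ(G, c) ∈ {0, 1}` (relative to a base type `T₀`; part II shows the choice of `T₀` is immaterial): `1` iff the weight parity
is constant on blocks, i.e. invariant under every base change. [folklore] -/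
def wdelta (T₀ : CMF G c) : ℕ := by
  classical
  exact if ∀ (Q : G) (Ψ : CMF G c), wpar c T₀ (rt c Q Ψ) = wpar c T₀ Ψ then 1 else 0

/-- `δ = 1` when the weight parity is base-change invariant. [folklore] -/
theorem wdelta_eq_one {T₀ : CMF G c} (h : ∀ (Q : G) (Ψ : CMF G c), wpar c T₀ (rt c Q Ψ) = wpar c T₀ Ψ) :
    wdelta c T₀ = 1 := by
  unfold wdelta; rw [if_pos h]

/-- `δ = 0` when the weight parity is not base-change invariant. [folklore] -/
theorem wdelta_eq_zero {T₀ : CMF G c} (h : ¬ ∀ (Q : G) (Ψ : CMF G c), wpar c T₀ (rt c Q Ψ) = wpar c T₀ Ψ) :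
    wdelta c T₀ = 0 := by
  unfold wdelta; rw [if_neg h]

/-- `δ ≤ 1`. [folklore] -/
theorem wdelta_le_one (T₀ : CMF G c) : wdelta c T₀ ≤ 1 := by
  unfold wdelta; split_ifs <;> omega

omit [Fintype G] in
/-- The place of `c·t` is the place of `t`. [folklore] -/
theorem orb_cmul (hc2 : c * c = 1) (t : G) : orb c (c * t) = orb c t := by
  ext x; rw [mem_orb, mem_orb, cmul_cmul c hc2]; tauto

/-- Flipping at `c·t` is flipping at `t`. [folklore] -/
theorem oflipCM_cmul (hc2 : c * c = 1) (t : G) (Ψ : CMF G c) : oflipCM c hc2 (c * t) Ψ = oflipCM c hc2 t Ψ := by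
  apply Subtype.ext
  change oflip c (c * t) Ψ.1 = oflip c t Ψ.1
  rw [oflip, oflip, orb_cmul c hc2]

/-- Flipping at a place where `Ψ` agrees with `T₀` ADDS that place to the deviation set. [folklore] -/
theorem dev_oflip_of_mem (hc2 : c * c = 1) {T₀ Ψ : CMF G c} {s : G} (hsT : s ∈ T₀.1) (hsΨ : s ∈ Ψ.1) :
    T₀.1 \ (oflipCM c hc2 s Ψ).1 = insert s (T₀.1 \ Ψ.1) := by
  have hcsT : c * s ∉ T₀.1 := (T₀.2 s).mp hsT
  ext t
  rw [mem_insert, mem_sdiff, mem_sdiff]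
  change t ∈ T₀.1 ∧ t ∉ oflip c s Ψ.1 ↔ t = s ∨ t ∈ T₀.1 ∧ t ∉ Ψ.1
  rw [oflip, mem_symmDiff, mem_orb]
  by_cases hts : t = s
  · subst hts; simp [hsT, hsΨ]
  · by_cases htT : t ∈ T₀.1
    · have htcs : t ≠ c * s := fun hh => hcsT (hh ▸ htT)
      simp [htT, hts, htcs]
    · simp [htT, hts]

/-- **Every flip changes the weight parity** (at a place represented in `T₀` by `s`). [folklore] -/
theorem wpar_oflipCM_of_mem (hc2 : c * c = 1) (T₀ Ψ : CMF G c) {s : G} (hsT : s ∈ T₀.1) :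
    wpar c T₀ (oflipCM c hc2 s Ψ) = wpar c T₀ Ψ + 1 := by
  unfold wpar
  by_cases hsΨ : s ∈ Ψ.1
  · rw [dev_oflip_of_mem c hc2 hsT hsΨ, card_insert_of_notMem (fun h => (mem_sdiff.mp h).2 hsΨ)]
    push_cast; ring
  · rw [dev_oflip c hc2 hsT hsΨ, card_erase_of_mem (mem_sdiff.mpr ⟨hsT, hsΨ⟩)]
    have h1 : 1 ≤ (T₀.1 \ Ψ.1).card := card_pos.mpr ⟨s, mem_sdiff.mpr ⟨hsT, hsΨ⟩⟩
    rw [Nat.cast_sub h1]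
    have h2 : ((1 : ℕ) : ZMod 2) = -1 := by decide
    rw [h2]; ring

/-- **Every flip changes the weight parity.** [folklore] -/
theorem wpar_oflipCM (hc2 : c * c = 1) (T₀ Ψ : CMF G c) (t : G) :
    wpar c T₀ (oflipCM c hc2 t Ψ) = wpar c T₀ Ψ + 1 := by
  by_cases ht : t ∈ T₀.1
  · exact wpar_oflipCM_of_mem c hc2 T₀ Ψ ht
  · have hct : c * t ∈ T₀.1 := by
      by_contra h; exact ht ((T₀.2 t).mpr h)
    rw [← oflipCM_cmul c hc2 t Ψ]
    exact wpar_oflipCM_of_mem c hc2 T₀ Ψ hct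

/-- **Relation 1: the total parity of a face vanishes** (`Σ_B par(face)_B = 1 + 1 − 1 − 1 = 0`). [folklore] -/
theorem sum_par_gface (hc2 : c * c = 1) (Φ : CMF G c) (t t' : G) : ∑ B, par c (gface c hc2 Φ t t') B = 0 := by
  have key : ∀ (Ψ : CMF G c) (n : ℤ), ∑ B, par c (Finsupp.single Ψ n) B = (n : ZMod 2) := by
    intro Ψ n
    simp_rw [par_single_apply]
    rw [Finset.sum_ite_eq, if_pos (Finset.mem_univ _)]
  unfold gface
  simp only [map_add, map_sub, Finset.sum_add_distrib, Finset.sum_sub_distrib, Pi.add_apply, Pi.sub_apply, key]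
  push_cast; ring

/-- **Relation 2: the weighted parity of a face vanishes** (`w(Φ) + w(Φ^{(tt')}) − w(Φ^{(t)}) − w(Φ^{(t')}) = 0`, as every
flip changes `w`). [folklore] -/
theorem wlin_gface (hc2 : c * c = 1) (T₀ Φ : CMF G c) (t t' : G) : wlin c T₀ (gface c hc2 Φ t t') = 0 := by
  unfold gface
  rw [map_sub, map_sub, map_add, wlin_single, wlin_single, wlin_single, wlin_single, wpar_oflipCM, wpar_oflipCM,
    wpar_oflipCM]
  push_cast; ring

end

end Summit.HodgeConjecture.CorCM.Census.BlockParity
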